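import Literature.AnabelianGeometry.EtaleTheta.TemperedFrobenioidGenuineWeakPiNat
import Literature.AnabelianGeometry.EtaleTheta.Discharge.Sec3Cor38iiiOfRlfWeak
import Literature.AnabelianGeometry.EtaleTheta.NoPhantomSupportCountable
import HarnessLib

/-!
# [EtTh] Cor. 3.8 (iii), first clause, at INFINITELY many special-fibre components: the weak-vocabulary apex
# FIRES with no binder at `WeakPiNat.genuineTemperedFrobenioid` (closed instance)

Mochizuki, *The étale theta function …*, Publ. RIMS **45** (2009), Cor. 3.8 (iii) p.81 (proof p.82), Def. 3.6 (ii)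
p.77, Prop. 3.2 (i) p.70, Prop. 3.4 (ii) p.74 [cite: MochizukiEtTh2009, Cor 3.8 p.81]; Mochizuki, *The geometry of
Frobenioids I* (2008), Thm. 5.2 (ii) p.100 (model Frobenioids are Frobenioids) [cite: MochizukiFrdI2008, Thm. 5.2(ii) p.100].

abc-iut cell, layer L2, ROW «NV-L2/TemperedFrobenioid-WEAK-∞» (abc-iut-L2-lead gen 4, R227; seat abc-iut-L2-d2 gen 4),
file 3/3 (proof-only).  For the tempered Frobenioid `C := WeakPiNat.genuineTemperedFrobenioid R S` of
`TemperedFrobenioidGenuineWeakPiNat.lean` (Def. 3.6 (ii) over `treeMonoidVocabWeak` at `Φ₀ = ∏_ℕ ℤ_{≥0}`, where the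
PRINTED-vocabulary interface is empty, F-L2d2-1) every residual input of this seat's weak Cor. 3.8 (iii) apex
`cor38_iii_ofRlfZWeak_of_isFrobenioid_of_countable_of_prop34Const` (`Discharge/Sec3Cor38iiiOfRlfWeak.lean`) is a
THEOREM:
* `isFrobenioid_genuineTemperedFrobenioid` — `C → F_Φ` IS a Frobenioid ([FrdI] Thm. 5.2 (ii), abc-iut-found's
  `ModelFrobenioid.isFrobenioid`);
* `countable_primes_perfection_Φ` — **GAP-LEDGER G-L2d2-4 DISCHARGED at the instance**: the primes of `Φ(A)^pf`,
  `Φ(A) = ι(Φ₀^pf) ≅ (∏_ℕ ℤ_{≥0})^pf`, are countable (`PiNat.countable_primes_perfection`);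
* `prop34Const_divisorMonoids` — **abc-iut-L2-t3's Prop. 3.4 (ii) bundle `DivisorMonoids.Prop34Const` (G-L2d2-3)
  HOLDS for the datum** (`div₀(ϖ^n) = d^n`, `d ≠ 0` non-cuspidal);
* `nonempty_cor38Hyp` — the Cor. 3.8 data are inhabited (`Ψ := 𝟭`; `D` of FSM- hence FSMFF-type; `Φ` non-dilating);
* **`cor38_iii_genuineTemperedFrobenioid : ∀ h : Cor38Hyp C C', Cor38_iii h`** for `C`, `C'` any two of these
  witnesses — [EtTh] Cor. 3.8 (iii), first clause, AS TYPED, with NO hypothesis, at a tempered Frobenioid with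
  infinitely many special-fibre components: the cell's weak §3 chain (abc-iut-L2-d2 / L6-t12 / L2-t3 / L1-t12 / f-038 /
  w5-d124 / w5-d135 lineages) is NON-VACUOUS exactly in the F-L2d2-1 regime.

HONEST LABEL: a degenerate but GENUINE-vocabulary instance (one object, no cusps, constant functions only); a
consistency / instantiation certificate for OUR typing, not a statement about a curve; nothing here bears on
[IUTchIII] Cor. 3.12.  No definitions.
-/

noncomputable section

namespace Literature.AnabelianGeometry.EtaleTheta

open CategoryTheory Opposite Literature.AlgebraicGeometry.Frobenioids

namespace WeakPiNat

variable (R S : ((Discrete PUnit.{1})ᵒᵖ ⥤ CommMonCat.{0}) → Prop)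

/-! ### `C → F_Φ` is a Frobenioid ([FrdI] Thm. 5.2 (ii)) -/

/-- **The weak-vocabulary witness is a Frobenioid**: `hF` for `(genuineTemperedFrobenioid R S).toElem`, by [FrdI]
Thm. 5.2 (ii) (`ModelFrobenioid.isFrobenioid`) — `Φ` and `B` are monoids on the one-object base, `Φ` is divisorial
(`PfImageWeak.isDivisorial_mrange_toRealification`), `B` is group-like, `D` is connected and totally epimorphic.
[cite: MochizukiFrdI2008, Thm. 5.2(ii) p.100] -/
theorem isFrobenioid_genuineTemperedFrobenioid :
    PreFrobenioid.IsFrobenioid (genuineTemperedFrobenioid R S).toElem :=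
  ModelFrobenioid.isFrobenioid
    (Cor38Toy.isMonoidOn_of_punit _)
    (fun A => PfImageWeak.isDivisorial_mrange_toRealification (isPerfFactorialCof_Φ₀ (op A)))
    (Cor38Toy.isMonoidOn_of_punit _)
    ((genuineTemperedFrobenioid R S).isGroupLike_ratFnFunctor realified.isUnit_BΛ)
    (isGraphConnected_iff_isConnected.mpr (genuineTemperedFrobenioid R S).isConnected)
    (genuineTemperedFrobenioid R S).isTotallyEpimorphic

/-! ### The residual inputs of the weak Cor. 3.8 (iii) apex are theorems here -/

/-- **G-L2d2-4 at the instance**: the primes of `Φ(A)^pf` are countable — `Φ(A) = ι(Φ₀(Y)^pf) ≅ (∏_ℕ ℤ_{≥0})^pf`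
(`PfImageWeak.mrangeRestrict_toRealification_bijective`), whose primes are the countably many coordinates
(`PiNat.countable_primes_perfection`; `Prime(M) ≃ Prime(M^pf)` for sharp `M`). [cite: MochizukiEtTh2009, Prop 3.2 p.70] -/
theorem countable_primes_perfection_Φ (A : (Discrete PUnit.{1})ᵒᵖ) :
    Countable (Primes (Perfection ↥((genuineTemperedFrobenioid R S).Φ.carrier A))) := by
  have hM := isPerfFactorialCof_Φ₀ A
  haveI : Countable (Primes (Perfection ↥(divisorMonoids.Φ₀.obj A))) := PiNat.countable_primes_perfection ℕ
  haveI : Countable (Primes ↥(MonoidHom.mrange hM.weak.toRealification)) :=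
    countable_primes_of_mulEquiv
      (MulEquiv.ofBijective _ (PfImageWeak.mrangeRestrict_toRealification_bijective hM.weak))
  exact (PfImageWeak.isPerfFactorialCof_mrange_toRealification hM).weak.countable_primes_perfection

/-- **G-L2d2-3 at the instance**: abc-iut-L2-t3's [EtTh] Prop. 3.4 (ii) bundle `Prop34Const` HOLDS for the datum —
`F₀ = ϖ^ℤ` is a group, and `div₀(ϖ^n) = d^n` with `d = (1, 1, …) ≠ 0` non-cuspidal, attained at `ϖ`.
[cite: MochizukiEtTh2009, Prop 3.4 p.74] -/
theorem prop34Const_divisorMonoids : DivisorMonoids.Prop34Const WeakPiNat.divisorMonoids where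
  inv_mem_F₀ _ b _ := ⟨b⁻¹, Submonoid.mem_top _, inv_mul_cancel b⟩
  exists_specialFibre Y := by
    refine ⟨diag, Submonoid.mem_top _, diag_ne_one, ⟨Multiplicative.ofAdd (1 : ℤ), Submonoid.mem_top _,
      divHom_ofAdd_one⟩, fun b _ => ⟨Multiplicative.toAdd (show Multiplicative ℤ from b), ?_⟩⟩
    change divHom b = _
    rw [divHom, zpowersHom_apply]

/-- `Φ` of the witness is non-dilating under the endomorphisms of the base (identities).
[cite: MochizukiEtTh2009, Cor 3.8 p.80] -/
theorem genuineTemperedFrobenioid_nonDilating (A : (Discrete PUnit.{1})ᵒᵖ) (f : A ⟶ A) :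
    treeMonoidVocabWeak.IsNonDilating _ ((genuineTemperedFrobenioid R S).Φ.pull f) := by
  have hf : f = 𝟙 A := Quiver.Hom.unop_inj (Subsingleton.elim _ _)
  subst hf
  rw [treeMonoidVocabWeak_isNonDilating]
  have hpull : (genuineTemperedFrobenioid R S).Φ.pull (𝟙 A) = MonoidHom.id _ := by
    ext x
    rw [SubMonoidOn.coe_pull, CategoryTheory.Functor.map_id, MonoidHom.id_apply]
    rfl
  rw [hpull]
  exact Example39NV.isNonDilating_id

/-- **`Cor38Hyp` is inhabited at the witness**: for `C₁ = C₂ := genuineTemperedFrobenioid R S` and `Ψ := 𝟭`, the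
standing hypotheses of [EtTh] Cor. 3.8 ("`D_i` of FSMFF-type, `Φ_i` non-dilating, `Ψ : C₁ ≅ C₂` an equivalence") hold
— `D` is of FSM-type hence of FSMFF-type ([FrdI] §0). [cite: MochizukiEtTh2009, Cor 3.8 p.80] -/
theorem nonempty_cor38Hyp :
    Nonempty (Cor38Hyp (genuineTemperedFrobenioid R S) (genuineTemperedFrobenioid R S)) :=
  ⟨{ Ψ := CategoryTheory.Equivalence.refl
     fsmff := ⟨PadicFrd.isOfFSMType_discretePUnit.isOfFSMFFType, PadicFrd.isOfFSMType_discretePUnit.isOfFSMFFType⟩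
     nonDilating := ⟨genuineTemperedFrobenioid_nonDilating R S, genuineTemperedFrobenioid_nonDilating R S⟩ }⟩

/-! ### The apex fires -/

variable (R' S' : ((Discrete PUnit.{1})ᵒᵖ ⥤ CommMonCat.{0}) → Prop)

/-- **[EtTh] Cor. 3.8 (iii), first clause ("`Ψ` preserves the non-cuspidal and cuspidal pre-steps"), AS TYPED by
abc-iut-L2-t3 (`Cor38_iii h`), holds with NO hypothesis for EVERY Cor. 3.8 datum `h` between two weak-vocabulary
witnesses at `Φ₀ = ∏_ℕ ℤ_{≥0}`** — this seat's apex `cor38_iii_ofRlfZWeak_of_isFrobenioid_of_countable_of_prop34Const`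
(every row of the printed proof — [FrdI] Thm. 3.4 (ii)/(iii), Thm. 3.7 (i)(ii), Thm. 4.2 (i) for weakly perf-factorial
`Φ_i` —, (R3) by countability, `hD1` by Prop. 3.4 (ii)) with its three residual inputs `IsFrobenioid`, `hcnt`,
`Prop34Const` DISCHARGED above.  Non-vacuity of the cell's weak [EtTh] §3 chain in the F-L2d2-1 regime.
[cite: MochizukiEtTh2009, Cor 3.8 p.81] -/
theorem cor38_iii_genuineTemperedFrobenioid
    (h : Cor38Hyp (genuineTemperedFrobenioid R S) (genuineTemperedFrobenioid R' S')) : Cor38_iii h :=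
  cor38_iii_ofRlfZWeak_of_isFrobenioid_of_countable_of_prop34Const h
    (countable_primes_perfection_Φ R S) (countable_primes_perfection_Φ R' S')
    prop34Const_divisorMonoids prop34Const_divisorMonoids
    (isFrobenioid_genuineTemperedFrobenioid R S) (isFrobenioid_genuineTemperedFrobenioid R' S')

/-- Hence `Cor38_iii` is INHABITED by a Cor. 3.8 datum over the weak vocabulary at infinitely many special-fibre
components: `∃ h, Cor38_iii h` at the witness. [cite: MochizukiEtTh2009, Cor 3.8 p.81] -/
theorem exists_cor38Hyp_cor38_iii :
    ∃ h : Cor38Hyp (genuineTemperedFrobenioid R S) (genuineTemperedFrobenioid R S), Cor38_iii h :=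
  (nonempty_cor38Hyp R S).elim fun h => ⟨h, cor38_iii_genuineTemperedFrobenioid R S R S h⟩

end WeakPiNat

end Literature.AnabelianGeometry.EtaleTheta

end
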